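import Mathlib.Analysis.Calculus.Deriv.Inverse
import Mathlib.Analysis.Calculus.Deriv.Comp
import Mathlib.Analysis.Calculus.Deriv.Add
import Mathlib.Analysis.Calculus.Deriv.Mul
import Mathlib.Topology.Order.IntermediateValue
import Mathlib.Topology.Order.MonotoneContinuity
import Mathlib.Order.Hom.Set
import HarnessLib

/-!
# Equal-phase reparametrisation: existence, continuity, derivative (layer T, R1-DESIGN §6 G2 / G6 (iv))

HONEST FRAMING (cell `pub-fluidc`, blueprint seat bp3, gen 17): low prior, high value-of-information
experiment on Tao's machine paradigm; NOT a claim that NS blows up. Pure one-variable real analysis;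
nothing here mentions a fluid.

WHY. The ramp enclosure compares a perturbed trajectory `y` with the reference `x̂` AT EQUAL PHASE:
`e(t) := y(s(t)) − x̂(t)` where the phase `τ` (a coordinate of the state, monotone along both
trajectories on the window) satisfies `τ(y(s(t))) = τ(x̂(t))`. Everything in layer T rests on the
existence of `s`, its continuity, and the identities `ṡ = χ'(t)/ψ'(s(t))` (`ψ := τ ∘ y`, `χ := τ ∘ x̂`;
in the model `ṡ = Φ/(Φ + V_τ)`) and `ė = ṡ·ẏ(s) − x̂'` (R1-DESIGN G2). This file proves them once,
abstractly, by the one-dimensional inverse-function argument: a function `ψ` continuous and strictly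
increasing on `[a, b]` is extended to a strictly increasing continuous bijection of `ℝ`
(`extend ψ a b σ := ψ(clampI σ) + (σ − clampI σ)`), inverted as an order isomorphism, and the inverse is
differentiated with `HasDerivAt.of_local_left_inverse`.

RESULTS. `inv` (the inverse), `extend_inv` / `inv_extend` / `inv_eq_of_eq` (it inverts `ψ` on
`[a, b]`, uniquely), `continuous_inv`, `hasDerivAt_inv` (derivative `1/ψ'` at interior points),
and the packaged statement `reparam_hasDerivWithinAt`: for `s := inv ∘ χ`,
`HasDerivWithinAt s (χ'/ψ'(s t)) (Ici t) t`, plus `deviation_hasDerivWithinAt`: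
`e i := y (s ·) i − x · i` has right derivative `ṡ·y'ᵢ(s t) − x'ᵢ(t)`.

[cite: Tao2016AveragedNS, §5.5 Thm 5.3 (5.5)]
-/

noncomputable section

open Set Filter Topology

namespace Summit.NavierStokesRegularity.FluidComputer

namespace Reparam

/-- The clampI `σ ↦ max a (min σ b)` onto `[a, b]`. [folklore] -/
def clampI (a b σ : ℝ) : ℝ := max a (min σ b)

/-- The clampI lands in `[a, b]`. [folklore] -/
theorem clampI_mem {a b : ℝ} (hab : a ≤ b) (σ : ℝ) : clampI a b σ ∈ Icc a b :=
  ⟨le_max_left _ _, max_le hab (min_le_right _ _)⟩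

/-- The clampI fixes points of `[a, b]`. [folklore] -/
theorem clampI_eq {a b σ : ℝ} (hσ : σ ∈ Icc a b) : clampI a b σ = σ := by
  unfold clampI
  rw [min_eq_left hσ.2, max_eq_right hσ.1]

/-- The clampI is monotone and 1-Lipschitz (one-sided form). [folklore] -/
theorem clampI_le_clampI {a b σ σ' : ℝ} (hab : a ≤ b) (h : σ ≤ σ') :
    clampI a b σ ≤ clampI a b σ' ∧ clampI a b σ' - clampI a b σ ≤ σ' - σ := by
  unfold clampI
  simp only [max_def, min_def]
  split_ifs <;> constructor <;> linarith

/-- The clampI is continuous. [folklore] -/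
theorem continuous_clampI (a b : ℝ) : Continuous (clampI a b) :=
  continuous_const.max (continuous_id.min continuous_const)

/-- Strictly increasing continuous extension of `ψ|[a,b]` to all of `ℝ`. [folklore] -/
def extend (ψ : ℝ → ℝ) (a b : ℝ) (σ : ℝ) : ℝ := ψ (clampI a b σ) + (σ - clampI a b σ)

/-- The extension agrees with `ψ` on `[a, b]`. [folklore] -/
theorem extend_eq {ψ : ℝ → ℝ} {a b σ : ℝ} (hσ : σ ∈ Icc a b) : extend ψ a b σ = ψ σ := by
  simp [extend, clampI_eq hσ]

/-- The extension is continuous when `ψ` is continuous on `[a, b]`. [folklore] -/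
theorem continuous_extend {ψ : ℝ → ℝ} {a b : ℝ} (hab : a ≤ b) (hψ : ContinuousOn ψ (Icc a b)) :
    Continuous (extend ψ a b) := by
  have h1 : Continuous (fun σ => ψ (clampI a b σ)) :=
    hψ.comp_continuous (continuous_clampI a b) (clampI_mem hab)
  exact h1.add (continuous_id.sub (continuous_clampI a b))

/-- The extension is strictly increasing when `ψ` is strictly increasing on `[a, b]`. [folklore] -/
theorem strictMono_extend {ψ : ℝ → ℝ} {a b : ℝ} (hab : a ≤ b) (hψ : StrictMonoOn ψ (Icc a b)) :
    StrictMono (extend ψ a b) := by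
  intro σ σ' hlt
  obtain ⟨h1, h2⟩ := clampI_le_clampI hab hlt.le
  unfold extend
  rcases h1.lt_or_eq with hlt' | heq
  · have := hψ (clampI_mem hab σ) (clampI_mem hab σ') hlt'
    linarith
  · rw [heq]; linarith

/-- The extension tends to `+∞` at `+∞`. [folklore] -/
theorem tendsto_extend_atTop {ψ : ℝ → ℝ} {a b : ℝ} (hab : a ≤ b) :
    Tendsto (extend ψ a b) atTop atTop := by
  refine tendsto_atTop_atTop.2 fun y => ⟨max b (y - ψ b + b), fun σ hσ => ?_⟩
  have hbσ : b ≤ σ := (le_max_left _ _).trans hσ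
  have hc : clampI a b σ = b := by unfold clampI; rw [min_eq_right hbσ, max_eq_right hab]
  unfold extend; rw [hc]; linarith [(le_max_right _ _).trans hσ]

/-- The extension tends to `−∞` at `−∞`. [folklore] -/
theorem tendsto_extend_atBot {ψ : ℝ → ℝ} {a b : ℝ} (hab : a ≤ b) :
    Tendsto (extend ψ a b) atBot atBot := by
  refine tendsto_atBot_atBot.2 fun y => ⟨min a (y - ψ a + a), fun σ hσ => ?_⟩
  have hσa : σ ≤ a := hσ.trans (min_le_left _ _)
  have hc : clampI a b σ = a := by
    unfold clampI; rw [min_eq_left (hσa.trans hab), max_eq_left hσa]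
  unfold extend; rw [hc]; linarith [hσ.trans (min_le_right _ _)]

/-- The extension is surjective. [folklore] -/
theorem surjective_extend {ψ : ℝ → ℝ} {a b : ℝ} (hab : a ≤ b) (hψ : ContinuousOn ψ (Icc a b)) :
    Function.Surjective (extend ψ a b) :=
  (continuous_extend hab hψ).surjective (tendsto_extend_atTop hab) (tendsto_extend_atBot hab)

/-- The extension as an order isomorphism of `ℝ`. [folklore] -/
def iso {ψ : ℝ → ℝ} {a b : ℝ} (hab : a ≤ b) (hψc : ContinuousOn ψ (Icc a b))
    (hψm : StrictMonoOn ψ (Icc a b)) : ℝ ≃o ℝ :=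
  (strictMono_extend hab hψm).orderIsoOfSurjective _ (surjective_extend hab hψc)

/-- **The inverse phase map** `ψ⁻¹` (extended to all of `ℝ`). [folklore] -/
def inv {ψ : ℝ → ℝ} {a b : ℝ} (hab : a ≤ b) (hψc : ContinuousOn ψ (Icc a b))
    (hψm : StrictMonoOn ψ (Icc a b)) : ℝ → ℝ :=
  fun x => (iso hab hψc hψm).symm x

section

variable {ψ : ℝ → ℝ} {a b : ℝ} (hab : a ≤ b) (hψc : ContinuousOn ψ (Icc a b))
  (hψm : StrictMonoOn ψ (Icc a b))

/-- The order isomorphism is the extension. [folklore] -/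
theorem iso_apply (σ : ℝ) : iso hab hψc hψm σ = extend ψ a b σ := by
  rw [iso, StrictMono.coe_orderIsoOfSurjective]

/-- `inv` is a right inverse of the extension. [folklore] -/
theorem extend_inv (x : ℝ) : extend ψ a b (inv hab hψc hψm x) = x := by
  have h := (iso hab hψc hψm).apply_symm_apply x
  rwa [iso_apply] at h

/-- `inv` is a left inverse of the extension. [folklore] -/
theorem inv_extend (σ : ℝ) : inv hab hψc hψm (extend ψ a b σ) = σ := by
  have h := (iso hab hψc hψm).symm_apply_apply σ
  rwa [iso_apply] at h

/-- `inv` inverts `ψ` itself on `[a, b]`. [folklore] -/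
theorem inv_apply_of_mem {σ : ℝ} (hσ : σ ∈ Icc a b) : inv hab hψc hψm (ψ σ) = σ := by
  have h := inv_extend hab hψc hψm σ
  rwa [extend_eq hσ] at h

/-- Uniqueness: the only `σ ∈ [a, b]` with `ψ σ = x` is `inv x`. [folklore] -/
theorem inv_eq_of_eq {σ x : ℝ} (hσ : σ ∈ Icc a b) (h : ψ σ = x) : inv hab hψc hψm x = σ := by
  rw [← h, inv_apply_of_mem hab hψc hψm hσ]

/-- The inverse phase map is continuous. [folklore] -/
theorem continuous_inv : Continuous (inv hab hψc hψm) := (iso hab hψc hψm).symm.continuous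

/-- The inverse phase map is strictly increasing. [folklore] -/
theorem strictMono_inv : StrictMono (inv hab hψc hψm) := (iso hab hψc hψm).symm.strictMono

/-- Values in the open phase range come from interior parameters. [folklore] -/
theorem inv_mem_Ioo {x : ℝ} (hx : x ∈ Ioo (ψ a) (ψ b)) : inv hab hψc hψm x ∈ Ioo a b := by
  have ha : inv hab hψc hψm (ψ a) = a := inv_apply_of_mem hab hψc hψm ⟨le_rfl, hab⟩
  have hb : inv hab hψc hψm (ψ b) = b := inv_apply_of_mem hab hψc hψm ⟨hab, le_rfl⟩
  constructor
  · have := strictMono_inv hab hψc hψm hx.1; rwa [ha] at this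
  · have := strictMono_inv hab hψc hψm hx.2; rwa [hb] at this

/-- Values in the closed phase range come from parameters in `[a, b]`. [folklore] -/
theorem inv_mem_Icc {x : ℝ} (hx : x ∈ Icc (ψ a) (ψ b)) : inv hab hψc hψm x ∈ Icc a b := by
  have ha : inv hab hψc hψm (ψ a) = a := inv_apply_of_mem hab hψc hψm ⟨le_rfl, hab⟩
  have hb : inv hab hψc hψm (ψ b) = b := inv_apply_of_mem hab hψc hψm ⟨hab, le_rfl⟩
  constructor
  · have := (strictMono_inv hab hψc hψm).monotone hx.1; rwa [ha] at this
  · have := (strictMono_inv hab hψc hψm).monotone hx.2; rwa [hb] at this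

/-- `ψ (inv x) = x` on the phase range. [folklore] -/
theorem apply_inv {x : ℝ} (hx : x ∈ Icc (ψ a) (ψ b)) : ψ (inv hab hψc hψm x) = x := by
  have h := extend_inv hab hψc hψm x
  rwa [extend_eq (inv_mem_Icc hab hψc hψm hx)] at h

/-- **Derivative of the inverse** at a point of the open phase range where `ψ' ≠ 0`. [folklore] -/
theorem hasDerivAt_inv {x ψ' : ℝ} (hx : x ∈ Ioo (ψ a) (ψ b))
    (hψ' : HasDerivAt ψ ψ' (inv hab hψc hψm x)) (hne : ψ' ≠ 0) :
    HasDerivAt (inv hab hψc hψm) ψ'⁻¹ x := by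
  have hmem := inv_mem_Ioo hab hψc hψm hx
  have hext : HasDerivAt (extend ψ a b) ψ' (inv hab hψc hψm x) := by
    refine hψ'.congr_of_eventuallyEq ?_
    filter_upwards [Ioo_mem_nhds hmem.1 hmem.2] with σ hσ
    exact extend_eq (Ioo_subset_Icc_self hσ)
  refine hext.of_local_left_inverse (continuous_inv hab hψc hψm).continuousAt hne ?_
  exact Eventually.of_forall fun y => extend_inv hab hψc hψm y

/-- **The reparametrisation `s := ψ⁻¹ ∘ χ` and its right derivative `χ'/ψ'(s t)`.** [folklore] -/
theorem reparam_hasDerivWithinAt {χ : ℝ → ℝ} {t χ' ψ' : ℝ} {S : Set ℝ}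
    (hχt : χ t ∈ Ioo (ψ a) (ψ b)) (hχ : HasDerivWithinAt χ χ' S t)
    (hψ' : HasDerivAt ψ ψ' (inv hab hψc hψm (χ t))) (hne : ψ' ≠ 0) :
    HasDerivWithinAt (fun r => inv hab hψc hψm (χ r)) (χ' / ψ') S t := by
  have h := (hasDerivAt_inv hab hψc hψm hχt hψ' hne).comp_hasDerivWithinAt t hχ
  have heq : ψ'⁻¹ * χ' = χ' / ψ' := by rw [div_eq_mul_inv, mul_comm]
  rw [heq] at h
  exact h

/-- The reparametrisation `ψ⁻¹ ∘ χ` is continuous where `χ` is. [folklore] -/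
theorem reparam_continuousOn {χ : ℝ → ℝ} {S : Set ℝ} (hχ : ContinuousOn χ S) :
    ContinuousOn (fun r => inv hab hψc hψm (χ r)) S :=
  (continuous_inv hab hψc hψm).comp_continuousOn hχ

/-- **The equal-phase deviation and its right derivative**: with `s := ψ⁻¹ ∘ χ`,
`e i := y (s ·) i − x · i` has right derivative `ṡ · y'ᵢ(s t) − x'ᵢ(t)`. [folklore] -/
theorem deviation_hasDerivWithinAt {ι : Type*} {χ : ℝ → ℝ} {t χ' ψ' : ℝ} {S : Set ℝ}
    {y x : ℝ → ι → ℝ} {y' x' : ι → ℝ}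
    (hχt : χ t ∈ Ioo (ψ a) (ψ b)) (hχ : HasDerivWithinAt χ χ' S t)
    (hψ' : HasDerivAt ψ ψ' (inv hab hψc hψm (χ t))) (hne : ψ' ≠ 0)
    (hy : ∀ i, HasDerivAt (fun σ => y σ i) (y' i) (inv hab hψc hψm (χ t)))
    (hx : ∀ i, HasDerivWithinAt (fun r => x r i) (x' i) S t) (i : ι) :
    HasDerivWithinAt (fun r => y (inv hab hψc hψm (χ r)) i - x r i)
      ((χ' / ψ') * y' i - x' i) S t := by
  have hs := reparam_hasDerivWithinAt hab hψc hψm hχt hχ hψ' hne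
  have h1 : HasDerivWithinAt ((fun σ => y σ i) ∘ fun r => inv hab hψc hψm (χ r))
      (y' i * (χ' / ψ')) S t := (hy i).comp_hasDerivWithinAt t hs
  have h2 := h1.sub (hx i)
  have heq : y' i * (χ' / ψ') - x' i = (χ' / ψ') * y' i - x' i := by ring
  rw [heq] at h2
  exact h2

end

/-- **Phase-rate bound** (`ṡ = Φ/(Φ + V_τ)`, R1-DESIGN G2): if `0 < Φ`, `|v| ≤ D < Φ` then
`|Φ/(Φ + v) − 1| ≤ D/(Φ − D)`. [folklore] -/
theorem ratio_sub_one_le {Φ v D : ℝ} (hΦ : 0 < Φ) (hv : |v| ≤ D) (hD : D < Φ) :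
    |Φ / (Φ + v) - 1| ≤ D / (Φ - D) := by
  have h1 := neg_abs_le v
  have h2 := le_abs_self v
  have hpos : 0 < Φ + v := by linarith
  have hΦD : 0 < Φ - D := by linarith
  rw [div_sub_one hpos.ne', show Φ - (Φ + v) = -v by ring, abs_div, abs_neg, abs_of_pos hpos,
    div_le_div_iff₀ hpos hΦD]
  nlinarith [abs_nonneg v]

/-- **The equal-phase identity** `ṡ·ẏ(s) − x̂' = ṡ·P V` (R1-DESIGN G2), as pure algebra: with
`ẏ(s) = F(x̂) + V` (`V := Je + Q(e) + δF`), `x̂' = F(x̂)`, `Φ := F_p(x̂) ≠ 0`, `ṡ = Φ/(Φ + V_p)`,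
`P := I − F(x̂) e_pᵀ/Φ`: componentwise `ṡ (F i + V i) − F i = ṡ (V i − F i · V p / Φ)` (this part needs
only `ṡ = Φ/(Φ + V_p)`); with `F p = Φ` the `p`-component vanishes (`equalPhase_identity_phase`).
[folklore] -/
theorem equalPhase_identity {ι : Type*} {F V : ι → ℝ} {Φ sdot : ℝ} (p : ι) (hΦ : Φ ≠ 0)
    (hden : Φ + V p ≠ 0) (hs : sdot = Φ / (Φ + V p)) (i : ι) :
    sdot * (F i + V i) - F i = sdot * (V i - F i * V p / Φ) := by
  rw [hs]
  field_simp
  ring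

/-- The phase component of the equal-phase identity vanishes: `(P V)_p = 0`, so `ṡ·ẏ_p − x̂'_p = 0`. [folklore] -/
theorem equalPhase_identity_phase {ι : Type*} {F V : ι → ℝ} {Φ sdot : ℝ} (p : ι) (hΦ : Φ ≠ 0)
    (hden : Φ + V p ≠ 0) (hF : F p = Φ) (hs : sdot = Φ / (Φ + V p)) :
    sdot * (F p + V p) - F p = 0 := by
  rw [equalPhase_identity p hΦ hden hs p, hF]
  field_simp
  ring

end Reparam

end Summit.NavierStokesRegularity.FluidComputer
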